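import Mathlib
import Summits.Ventures.PercRepro2.HalfLA2BBlocks
import Summits.Ventures.PercRepro2.HalfLTwoMark

/-!
# HALF-L for `a₃` adjacent exactly to the root `a₂` and to `b` (blind cell PercRepro2, night-1 g37)

`GammaLc_a2b`: for `CaseOne.IsTwoMarkAt ends a₂ b a₃ e₁ e₂` (`a₃`'s only edges go to `a₂` and `b`),
`ΓLc = 2 · HalfLA2B.lhs (p e₁) (p e₂) (cells10Of …)`; hence **`HalfL_a2b`**: HALF-L on the class, every
weight, every base graph (the mirror class `a₃ ~ {a₁, b}` — whose certificates are deposited in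
`lean-drafts/night1g37/HalfLA1B*` — would give HALF-H and hence (HCOV) on `a₃ ~ {root, b}`).
-/

namespace Summit.Ventures.PercRepro2

namespace HalfLA2B

open CaseOne CovForm SharpHalves UnionCluster HalfLTwoMark

section Main

variable {V : Type*} {E : Type*} [Fintype E] [DecidableEq E] [Fintype V] [DecidableEq V]
  {R : Type*} [Field R] [LinearOrder R] [IsStrictOrderedRing R]
variable {ends : E → Sym2 V} {o a₃ b : V} {e₁ e₂ : E}

omit [Fintype V] in
/-- **`ΓLc` for `a₃ ~ {a₂, b}`**: `ΓLc = 2 · lhs r₁ r₂ (cells)`. -/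
theorem GammaLc_a2b (p : E → R) {a₁ a₂ : V} (h : IsTwoMarkAt ends a₂ b a₃ e₁ e₂) (h1 : a₁ ≠ a₃)
    (ho3 : o ≠ a₃) :
    GammaLc p ends o a₁ a₂ a₃ b = 2 * lhs (p e₁) (p e₂) (cells10Of p ends o a₁ a₂ b e₁ e₂) := by
  rw [HalfEndpoint.GammaLc_eq_endpoint p ends o a₁ a₂ a₃ b, HalfLTwoMark.Do_eq,
    HalfLTwoMark.avoidAll_eq_Q, HalfLTwoMark.TEvent_eq, HalfLTwoMark.Dtilde_eq]
  have ePD : PDEvent ends a₁ a₂ a₃ =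
      (connEvent ends a₁ a₂)ᶜ ∩ (connEvent ends a₃ a₁ ∪ connEvent ends a₃ a₂)ᶜ := rfl
  rw [ePD]
  have cT := prob_inter_add_prob_inter_compl p ((connEvent ends a₁ a₂)ᶜ ∩ connEvent ends a₂ a₃)
    (connEvent ends a₁ o ∪ connEvent ends a₂ o)
  have cTb := prob_inter_add_prob_inter_compl p
    ((connEvent ends a₁ a₂)ᶜ ∩ connEvent ends a₂ a₃ ∩ connEvent ends a₁ b)
    (connEvent ends a₁ o ∪ connEvent ends a₂ o)
  have eTb : (connEvent ends a₁ a₂)ᶜ ∩ connEvent ends a₂ a₃ ∩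
      (connEvent ends a₁ b ∩ (connEvent ends a₁ o ∪ connEvent ends a₂ o)ᶜ) =
      (connEvent ends a₁ a₂)ᶜ ∩ connEvent ends a₂ a₃ ∩ connEvent ends a₁ b ∩
        (connEvent ends a₁ o ∪ connEvent ends a₂ o)ᶜ := (Set.inter_assoc _ _ _).symm
  have ebLoH : (connEvent ends a₁ a₂)ᶜ ∩ (connEvent ends a₂ o ∩ connEvent ends a₁ b) =
      (connEvent ends a₁ a₂)ᶜ ∩ connEvent ends a₂ o ∩ connEvent ends a₁ b := (Set.inter_assoc _ _ _).symm
  rw [eTb, ebLoH]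
  rw [mass_Q p h h1, mass_bL p h h1, mass_T p h h1, mass_TbL p h h1, mass_TbLoU p h h1 ho3,
    mass_oH p h h1 ho3, mass_bLoH p h h1 ho3, mass_ToU p h h1 ho3, mass_PD p h h1,
    mass_PDoU p h h1 ho3] at *
  unfold lhs
  linear_combination (2 * mPD (p e₁) (p e₂) (cells10Of p ends o a₁ a₂ b e₁ e₂) *
      mbL (p e₁) (p e₂) (cells10Of p ends o a₁ a₂ b e₁ e₂)) * cT -
    (2 * mPD (p e₁) (p e₂) (cells10Of p ends o a₁ a₂ b e₁ e₂) *
      mQ (p e₁) (p e₂) (cells10Of p ends o a₁ a₂ b e₁ e₂)) * cTb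

/-- **HALF-L on the class `a₃ ~ {a₂, b}`**, every weight. -/
theorem HalfL_a2b (p : E → R) (hp : IsProbVec p) {a₁ a₂ : V} (h : IsTwoMarkAt ends a₂ b a₃ e₁ e₂)
    (h1 : a₁ ≠ a₃) (ho3 : o ≠ a₃) : HalfL p ends o a₁ a₂ a₃ b := by
  unfold HalfL
  rw [GammaLc_a2b p h h1 ho3]
  have := lhs_nonneg (p e₁) (p e₂) (cells10Of p ends o a₁ a₂ b e₁ e₂)
    (cellsNonneg p hp ends o a₁ a₂ b e₁ e₂) (blocksNonneg p hp ends o a₁ a₂ b e₁ e₂)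
    (hp.nonneg e₁) (hp.le_one e₁) (hp.nonneg e₂) (hp.le_one e₂)
  linarith

end Main

end HalfLA2B

end Summit.Ventures.PercRepro2
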